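import Literature.AnabelianGeometry.SemiGraphs.TemperedCompletionExistence

/-!
# B14 «PlusMinusTower.ofCoverModel», PRELIMINARY (the ambient `Π̂^cor_v`): residual finiteness passes to finite-index
# open overgroups, so `Π^tp_{C_v}` has an INJECTIVE profinite completion (proof-only, classical)

S. Mochizuki, *Inter-universal Teichmüller theory II*, kurims manuscript (Dec. 2020), §2, Def. 2.3 (i) p. 67: "`Π^cor_v := Π^tp_{C_v}`;
denote the respective profinite completions by means of a `∧` … we regard the various groups … as subgroups … of `Π̂^cor_v`"
([IUTchII] Def 2.3 (i), kurims p.67) [claim: Mochizuki2012, status: disputed]; [SemiAnbd] §6 p. 69 ("natural injection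
`Π^temp_{X_K} ↪ Π_{X_K}`") [cite: MochizukiSemiAnbd2006, §6 p.69].  PROOF-ONLY file (abc-iut cell, seat abc-iut-L6-t19 gen 5,
HOLDER-DESIGNATE of MERGE-MAP row B14, abc-iut-L6-lead §F v1.19e (3)); classical topological group theory over abc-iut-L3's
`IsProfiniteCompletion` (`TemperedCompletionExistence.lean`: existence, uniqueness, `injective_iff`); no definitions.

WHY: the ambient group of abc-iut-L6-t1's `PlusMinusTower` is the profinite completion `Π̂^cor_v` of `Π^cor_v = Π^tp_{C_v}`, into which
`Π^tp_{C_v}` must INJECT (`emb_injective`).  abc-iut-L2's model gives `Π^tp_{X_v} = PiTemp` with an injective completion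
(`TemperedCurve.toHat_injective`) and `Π^tp_X ↪ Π^tp_C` an OPEN embedding of NORMAL range of index `2` (abc-iut-L2-t1's `MuTwoSetting`,
abc-iut-L2-d3's `CLevelData.isOpenEmbedding_inclX`).  The missing classical step (census input P-C1 of W3-L2-02, "derivable … by whoever
needs it first" — abc-iut-L2-d3 04:06:44Z):

* **`IsProfiniteCompletion.separated_of_isOpenEmbedding`** — if `f : F → G` is an open embedding of topological groups whose range is
  a normal subgroup of finite index, and the open normal finite-index subgroups of `F` separate points, then so do those of `G`
  (for `g = f x`: the normal core of the open finite-index image `f(U)` of a separating `U`; for `g ∉ f(F)`: `f(F)` itself);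
* `IsProfiniteCompletion.separated_of_injective` — conversely to `injective_iff`'s use: a group with an injective profinite
  completion is separated (restated corollary of abc-iut-L3's `injective_iff`);
* **`IsProfiniteCompletion.exists_injective_completion_of_isOpenEmbedding`** — hence `G` admits a profinite completion
  `ι : G ↪ Ĝ` with `IsProfiniteCompletion ι` and `ι` injective (abc-iut-L3's `exists_isProfiniteCompletion_injective`).

The application `Π^tp_C` (with `F := Π^tp_X`, `f := inclX`) is one line over abc-iut-L2-d3's `MuTwoSetting.CLevelData` and lands with
`PlusMinusTowerCoverModelPrelims.lean`.  Nothing here takes a side on [IUTchIII] Cor. 3.12.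
-/

noncomputable section

namespace Literature.AnabelianGeometry.SemiGraphs

namespace IsProfiniteCompletion

open Topology

universe u v

variable {F : Type u} {G : Type v} [Group F] [TopologicalSpace F]
  [Group G] [TopologicalSpace G] [IsTopologicalGroup G]

/-- **Residual finiteness passes to finite-index open overgroups**: let `f : F → G` be an open embedding of topological groups
whose range is normal of finite index; if the open normal subgroups of finite index of `F` separate the points of `F`, then those
of `G` separate the points of `G`.  PROOF: for `g ∉ f(F)` the open normal finite-index subgroup `f(F)` separates; for `g = f(x)`,
`x ≠ 1`, take a separating `U` for `x`; `f(U)` is open of finite index in `G`, so its normal core is closed of finite index, hence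
open, and misses `f(x)` (as `f(U)` does, `f` injective).  Classical. [cite: MochizukiSemiAnbd2006, §6 p.69] -/
theorem separated_of_isOpenEmbedding (f : F →* G) (hf : IsOpenEmbedding f) [hn : f.range.Normal]
    [hfi : f.range.FiniteIndex]
    (hF : ∀ x : F, x ≠ 1 → ∃ U : OpenNormalSubgroup F, U.toSubgroup.FiniteIndex ∧ x ∉ U.toSubgroup) :
    ∀ g : G, g ≠ 1 → ∃ U : OpenNormalSubgroup G, U.toSubgroup.FiniteIndex ∧ g ∉ U.toSubgroup := by
  intro g hg
  by_cases hmem : g ∈ f.range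
  · obtain ⟨x, rfl⟩ := hmem
    have hx : x ≠ 1 := fun h => hg (by rw [h, map_one])
    obtain ⟨U, hU, hxU⟩ := hF x hx
    haveI := hU
    -- the image `f(U)`: open, of finite index
    have hVopen : IsOpen ((U.toSubgroup.map f : Subgroup G) : Set G) := by
      rw [Subgroup.coe_map]
      exact hf.isOpenMap _ U.toOpenSubgroup.isOpen
    haveI hVfi : (U.toSubgroup.map f).FiniteIndex := by
      refine ⟨?_⟩
      rw [Subgroup.index_map, (MonoidHom.ker_eq_bot_iff f).mpr hf.injective, sup_bot_eq]
      exact mul_ne_zero hU.index_ne_zero hfi.index_ne_zero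
    -- its normal core: closed of finite index, hence open; normal
    have hNopen : IsOpen (((U.toSubgroup.map f).normalCore : Subgroup G) : Set G) :=
      Subgroup.isOpen_of_isClosed_of_finiteIndex _
        ((U.toSubgroup.map f).normalCore_isClosed (Subgroup.isClosed_of_isOpen _ hVopen))
    refine ⟨{ toOpenSubgroup := ⟨(U.toSubgroup.map f).normalCore, hNopen⟩
              isNormal' := Subgroup.normalCore_normal _ }, Subgroup.finiteIndex_normalCore _, ?_⟩
    intro hN
    have hV : f x ∈ U.toSubgroup.map f := Subgroup.normalCore_le _ hN
    obtain ⟨u, hu, hux⟩ := hV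
    exact hxU (hf.injective hux ▸ hu)
  · exact ⟨{ toOpenSubgroup := ⟨f.range, hf.isOpen_range⟩, isNormal' := hn }, hfi, hmem⟩

/-- A topological group with an injective profinite completion is separated by its open normal finite-index subgroups (the easy
direction of abc-iut-L3's `injective_iff`, restated for use as an INPUT shape). [cite: MochizukiSemiAnbd2006, §6 p.69] -/
theorem separated_of_injective {P : Type v} [Group P] [TopologicalSpace P] [IsTopologicalGroup P] {ι : F →ₜ* P}
    (h : IsProfiniteCompletion ι) (hinj : Function.Injective ι) :
    ∀ x : F, x ≠ 1 → ∃ U : OpenNormalSubgroup F, U.toSubgroup.FiniteIndex ∧ x ∉ U.toSubgroup :=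
  h.injective_iff.mp hinj

/-- **An open finite-index normal overgroup of a group with injective profinite completion has an injective profinite completion**
("`Π^tp_C ↪ Π̂_C`" from "`Π^tp_X ↪ Π̂_X`" and `[Π^tp_C : Π^tp_X] = 2`): combining `separated_of_injective`,
`separated_of_isOpenEmbedding` and abc-iut-L3's `exists_isProfiniteCompletion_injective`.  Classical.
[cite: MochizukiSemiAnbd2006, §6 p.69] -/
theorem exists_injective_completion_of_isOpenEmbedding {P : Type u} [Group P] [TopologicalSpace P]
    [IsTopologicalGroup P] {ιF : F →ₜ* P} (hF : IsProfiniteCompletion ιF) (hFinj : Function.Injective ιF)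
    (f : F →* G) (hf : IsOpenEmbedding f) [f.range.Normal] [f.range.FiniteIndex] :
    ∃ (Q : ProfiniteGrp.{v}) (ι : G →ₜ* Q), IsProfiniteCompletion ι ∧ Function.Injective ι :=
  exists_isProfiniteCompletion_injective G
    (separated_of_isOpenEmbedding f hf (separated_of_injective hF hFinj))

end IsProfiniteCompletion

end Literature.AnabelianGeometry.SemiGraphs

end
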